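import Literature.NumberTheory.EllipticCurves.HalfIntegralWeightForms
import HarnessLib

/-!
# Elementary properties of Shimura's `T(p²)` on `q`-expansions: commutativity and the
# unary theta series of weight `3/2`

Two facts about the Hecke operators `heckeTSq k χ p` of `HalfIntegralWeightForms` (Shimura 1973,
Thm. 1.7: `(T(p²) a)(n) = a(p² n) + χ(p) ((-1)^λ n / p) p^{λ-1} a(n) + χ(p²) p^{k-2} a(n/p²)`) that
hold on ALL coefficient sequences `ℕ → ℂ` and are proved here by direct computation; they are the
elementary ingredients of the Hecke half of Tunnell 1983, Thm 2 (pp. 327–328: `g θ₂`, `g θ₈` are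
`T(p²)`-eigenforms), recorded for `Tunnell1983_thm2_triv/chi2` (see
`Tunnell1983_thm2_triv_iff_isAlmostEigenform` in `TunnellFormsCuspidalProofs`):

* `heckeTSq_comm` — **`T(p²) T(q²) = T(q²) T(p²)`** for coprime `p, q` (any `k`, `χ`): the
  commutativity of the Hecke algebra [Shimura 1973, §1], which can replace the Petersson
  self-adjointness used by Tunnell on p. 327 to separate `g θ₈` from the theta series
  `∑ ψ(m) m q^{m²}`;
* (the companion fact that `T(p²)`, `p` odd, preserves supports in a class modulo `8` is
  `heckeTSq_apply_eq_zero_of_mod_eight` of `TunnellThetaCoefficients`;)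
* `heckeTSq_unaryTheta` — the sequence `e(m²) = χ₋₄(m) m`, `e = 0` off the squares (the
  `q`-expansion of `∑ χ₋₄(m) m q^{m²} = 2 g θ₃₂ - g θ₈`, Tunnell p. 327) satisfies
  `T(p²) e = χ₋₄(p)(1 + p) e` for odd primes `p` with `χ(p) = 1` ("its eigenvalue for `T(3²)` is
  `-4`", loc. cit.; Shimura 1973, (1.17)–(1.18) for the theta series `θ(z; ψ)` of weight `3/2`).

## References

* G. Shimura, *On modular forms of half integral weight*, Ann. of Math. 97 (1973) 440–481, §1,
  Thm. 1.7. [Shimura1973HalfIntegral]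
* J. B. Tunnell, *A classical Diophantine problem and modular forms of weight 3/2*, Invent. Math.
  72 (1983) 323–334, proof of Thm 2 (pp. 327–328). [Tunnell1983Congruent]
-/

noncomputable section

open scoped NumberTheorySymbols

namespace Literature.NumberTheory.EllipticCurves.ModularForms

/-! ### Jacobi symbols: removing coprime square factors -/

/-- `(p² x / q) = (x / q)` when `gcd(p, q) = 1`. [folklore] -/
theorem jacobiSym_sq_mul_left {p q : ℕ} (hpq : Nat.Coprime p q) (x : ℤ) :
    J((p : ℤ) ^ 2 * x | q) = J(x | q) := by
  rw [jacobiSym.mul_left, jacobiSym.sq_one' (by rw [Int.gcd_natCast_natCast]; exact hpq), one_mul]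

/-- `((-1)^λ (p² n) / q) = ((-1)^λ n / q)` when `gcd(p, q) = 1` (the residue symbol in `T(q²)`
evaluated at `p² n`). [folklore] -/
theorem jacobiSym_eps_sq_mul {p q : ℕ} (hpq : Nat.Coprime p q) (ε : ℤ) (n : ℕ) :
    J(ε * ((p ^ 2 * n : ℕ) : ℤ) | q) = J(ε * (n : ℤ) | q) := by
  rw [show ε * ((p ^ 2 * n : ℕ) : ℤ) = (p : ℤ) ^ 2 * (ε * n) by push_cast; ring]
  exact jacobiSym_sq_mul_left hpq _

/-! ### Divisibility bookkeeping for coprime squares -/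

/-- `q² ∣ p² n ↔ q² ∣ n` for `gcd(p, q) = 1`. [folklore] -/
theorem sq_dvd_sq_mul_iff {p q : ℕ} (hpq : Nat.Coprime p q) (n : ℕ) :
    q ^ 2 ∣ p ^ 2 * n ↔ q ^ 2 ∣ n := by
  have h : Nat.Coprime (q ^ 2) (p ^ 2) := (Nat.Coprime.pow 2 2 hpq).symm
  exact ⟨fun hd ↦ h.dvd_of_dvd_mul_left hd, fun hd ↦ hd.mul_left _⟩

/-- `(p² n)/q² = p² (n/q²)` when `q² ∣ n`. [folklore] -/
theorem sq_mul_div_sq {p q : ℕ} (n : ℕ) (h : q ^ 2 ∣ n) :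
    p ^ 2 * n / q ^ 2 = p ^ 2 * (n / q ^ 2) := by
  obtain ⟨m, rfl⟩ := h
  rcases Nat.eq_zero_or_pos (q ^ 2) with h0 | h0
  · simp [h0]
  · rw [Nat.mul_div_cancel_left _ h0, mul_left_comm, Nat.mul_div_cancel_left _ h0]

/-- For `p² ∣ n` and `gcd(p, q) = 1`: `q² ∣ n/p² ↔ q² ∣ n`. [folklore] -/
theorem sq_dvd_div_sq_iff {p q : ℕ} (hpq : Nat.Coprime p q) {n : ℕ} (h : p ^ 2 ∣ n) :
    q ^ 2 ∣ n / p ^ 2 ↔ q ^ 2 ∣ n := by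
  obtain ⟨m, rfl⟩ := h
  rcases Nat.eq_zero_or_pos (p ^ 2) with h0 | h0
  · have hp : p = 0 := by simpa using h0
    subst hp
    have hq : q = 1 := by simpa using hpq
    subst hq
    simp
  · rw [Nat.mul_div_cancel_left _ h0]
    exact (sq_dvd_sq_mul_iff hpq m).symm

/-- `n/p²/q² = n/q²/p²`. [folklore] -/
theorem div_sq_div_sq_comm (p q n : ℕ) : n / p ^ 2 / q ^ 2 = n / q ^ 2 / p ^ 2 := by
  rw [Nat.div_div_eq_div_mul, Nat.div_div_eq_div_mul, mul_comm]

/-- `((-1)^λ (n/q²) / p) = ((-1)^λ n / p)` for `q² ∣ n`, `gcd(q, p) = 1`. [folklore] -/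
theorem jacobiSym_eps_div_sq {p q : ℕ} (hqp : Nat.Coprime q p) {n : ℕ} (h : q ^ 2 ∣ n) (ε : ℤ) :
    J(ε * ((n / q ^ 2 : ℕ) : ℤ) | p) = J(ε * (n : ℤ) | p) := by
  obtain ⟨m, rfl⟩ := h
  rcases Nat.eq_zero_or_pos (q ^ 2) with h0 | h0
  · have hq : q = 0 := by simpa using h0
    subst hq
    have hp1 : p = 1 := by simpa using hqp
    subst hp1
    simp [jacobiSym.one_right]
  · rw [Nat.mul_div_cancel_left _ h0]
    exact (jacobiSym_eps_sq_mul hqp ε m).symm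

/-! ### Commutativity of the Hecke operators `T(p²)`, `T(q²)` -/

/-- **The Hecke operators `T(p²)` and `T(q²)` commute** (as operators on all coefficient sequences,
for coprime `p, q`, any weight `k/2` and character `χ`): Shimura 1973, §1 (the Hecke algebra of
half-integral weight is commutative), here checked directly on Shimura's formula (Thm. 1.7) for the
action on `q`-expansions — the nine terms of `T(p²)T(q²) a` match those of `T(q²)T(p²) a` after
`(p² m / q) = (m / q)`, `q² ∣ p² n ↔ q² ∣ n`. [cite: Shimura1973HalfIntegral, Thm. 1.7 and §1] -/
theorem heckeTSq_comm (k : ℕ) {N : ℕ} (χ : DirichletCharacter ℂ N) {p q : ℕ}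
    (hpq : Nat.Coprime p q) :
    heckeTSq k χ p ∘ₗ heckeTSq k χ q = heckeTSq k χ q ∘ₗ heckeTSq k χ p := by
  apply LinearMap.ext
  intro a
  funext n
  have hqp : Nat.Coprime q p := hpq.symm
  simp only [LinearMap.coe_comp, Function.comp_apply, heckeTSq_apply]
  -- residue symbols at `p² m` and `q² m`, divisibility by coprime squares
  simp only [jacobiSym_eps_sq_mul hpq, jacobiSym_eps_sq_mul hqp, sq_dvd_sq_mul_iff hpq,
    sq_dvd_sq_mul_iff hqp]
  by_cases hp : p ^ 2 ∣ n <;> by_cases hq : q ^ 2 ∣ n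
  · -- both divide
    simp only [hp, hq, if_true, (sq_dvd_div_sq_iff hpq hp).mpr hq, (sq_dvd_div_sq_iff hqp hq).mpr hp,
      jacobiSym_eps_div_sq hqp hq, jacobiSym_eps_div_sq hpq hp, sq_mul_div_sq n hq,
      sq_mul_div_sq n hp, div_sq_div_sq_comm q p n]
    ring_nf
  · -- `p² ∣ n`, `q² ∤ n`
    have hq' : ¬ q ^ 2 ∣ n / p ^ 2 := fun h ↦ hq ((sq_dvd_div_sq_iff hpq hp).mp h)
    simp only [hp, hq, hq', if_true, if_false, jacobiSym_eps_div_sq hpq hp, sq_mul_div_sq n hp,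
      mul_zero, add_zero]
    ring_nf
  · -- `p² ∤ n`, `q² ∣ n`
    have hp' : ¬ p ^ 2 ∣ n / q ^ 2 := fun h ↦ hp ((sq_dvd_div_sq_iff hqp hq).mp h)
    simp only [hp, hq, hp', if_true, if_false, jacobiSym_eps_div_sq hqp hq, sq_mul_div_sq n hq,
      mul_zero, add_zero]
    ring_nf
  · simp only [hp, hq, if_false, mul_zero, add_zero]
    ring_nf

/-! ### The unary theta series of weight `3/2` is a `T(p²)`-eigenform -/

/-- `χ₋₄(p)² = 1` for odd `p`. [folklore] -/
theorem χ₄_sq_of_odd {p : ℕ} (hp : Odd p) : ((ZMod.χ₄ (p : ZMod 4) : ℤ) : ℂ) ^ 2 = 1 := by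
  have h := ZMod.χ₄_nat_eq_if_mod_four p
  rw [Nat.odd_iff.mp hp] at h
  simp only [Nat.one_ne_zero, if_false] at h
  split_ifs at h with h1 <;> rw [h] <;> norm_num

/-- `(-m²/p) = (-1/p) = χ₋₄(p)` for an odd prime `p ∤ m`. [folklore] -/
theorem jacobiSym_neg_sq_of_not_dvd {p : ℕ} (hp : p.Prime) (hp2 : p ≠ 2) {m : ℕ} (h : ¬ p ∣ m) :
    J(-((m : ℤ) ^ 2) | p) = ZMod.χ₄ (p : ZMod 4) := by
  have hodd : Odd p := hp.odd_of_ne_two hp2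
  rw [show -((m : ℤ) ^ 2) = -1 * (m : ℤ) ^ 2 by ring, jacobiSym.mul_left, jacobiSym.at_neg_one hodd,
    jacobiSym.pow_left]
  have hcop : (m : ℤ).gcd p = 1 := by
    rw [Int.gcd_natCast_natCast]
    exact (Nat.Coprime.symm ((Nat.Prime.coprime_iff_not_dvd hp).mpr h))
  rw [jacobiSym.sq_one hcop, mul_one]

/-- `(-m²/p) = 0` for a prime `p ∣ m`. [folklore] -/
theorem jacobiSym_neg_sq_of_dvd {p : ℕ} (hp : p.Prime) {m : ℕ} (h : p ∣ m) :
    J(-((m : ℤ) ^ 2) | p) = 0 := by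
  rw [jacobiSym.eq_zero_iff]
  refine ⟨hp.ne_zero, fun h1 ↦ ?_⟩
  rw [Int.gcd_eq_natAbs] at h1
  have hpm : p ∣ (-((m : ℤ) ^ 2)).natAbs := by
    rw [Int.natAbs_neg, Int.natAbs_pow, Int.natAbs_natCast]
    exact dvd_pow h two_ne_zero
  have : p ∣ Nat.gcd (-((m : ℤ) ^ 2)).natAbs (p : ℤ).natAbs := Nat.dvd_gcd hpm (by simp)
  rw [h1] at this
  exact hp.one_lt.ne' (Nat.dvd_one.mp this)

/-- `p² n` is a square only if `n` is (`p` prime). [folklore] -/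
theorem isSquare_of_isSquare_sq_mul {p : ℕ} (hp : p.Prime) {n : ℕ} (h : IsSquare (p ^ 2 * n)) :
    IsSquare n := by
  obtain ⟨x, hx⟩ := h
  have hpx : p ∣ x := by
    have : p ∣ x * x := ⟨p * n, by rw [← hx]; ring⟩
    exact (Nat.Prime.dvd_mul hp).mp this |>.elim id id
  obtain ⟨y, rfl⟩ := hpx
  refine ⟨y, ?_⟩
  have hp0 : 0 < p ^ 2 := pow_pos hp.pos 2
  have : p ^ 2 * n = p ^ 2 * (y * y) := by rw [hx]; ring
  exact Nat.eq_of_mul_eq_mul_left hp0 this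

/-- **The unary theta series `∑ χ₋₄(m) m q^{m²}` of weight `3/2` is a `T(p²)`-eigenform with
eigenvalue `χ₋₄(p)(1 + p)`** for every odd prime `p` at which the character of the space is
trivial (`χ(p) = 1`): if `e(m²) = χ₋₄(m) m` and `e(n) = 0` off the squares then
`T(p²) e = χ₋₄(p)(1 + p) e` (Shimura's formula: `e(p²m²) = χ₋₄(p) p e(m²)`, `(-m²/p) e(m²) = χ₋₄(p) e(m²)`
for `p ∤ m`, and `p e(m²/p²) = χ₋₄(p) e(m²)` for `p ∣ m`). This is the third basis vector
`2 g θ₃₂ - g θ₈ = ∑ χ₋₄(m) m q^{m²}` of `S_{3/2}(128, 1)` in Tunnell's proof of Thm 2 (p. 327: "its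
eigenvalue for `T(3²)` is `-4`" `= χ₋₄(3)(1 + 3)`). [cite: Shimura1973HalfIntegral, §1, (1.17)–(1.18)]
[cite: Tunnell1983Congruent, proof of Thm 2, p. 327] -/
theorem heckeTSq_unaryTheta {N : ℕ} (χ : DirichletCharacter ℂ N) {p : ℕ} (hp : p.Prime) (hp2 : p ≠ 2)
    (hχ : χ (p : ZMod N) = 1) {e : ℕ → ℂ}
    (hsq : ∀ m : ℕ, e (m ^ 2) = ((ZMod.χ₄ (m : ZMod 4) : ℤ) : ℂ) * m)
    (hnsq : ∀ n : ℕ, ¬ IsSquare n → e n = 0) :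
    heckeTSq 3 χ p e = (((ZMod.χ₄ (p : ZMod 4) : ℤ) : ℂ) * (1 + p)) • e := by
  have hodd : Odd p := hp.odd_of_ne_two hp2
  have hχ2 : χ ((p : ZMod N) ^ 2) = 1 := by rw [map_pow, hχ, one_pow]
  have hχ4sq := χ₄_sq_of_odd hodd
  have hmul : ∀ a b : ℕ, ((ZMod.χ₄ ((a * b : ℕ) : ZMod 4) : ℤ) : ℂ) =
      ((ZMod.χ₄ (a : ZMod 4) : ℤ) : ℂ) * ((ZMod.χ₄ (b : ZMod 4) : ℤ) : ℂ) := by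
    intro a b
    rw [Nat.cast_mul, map_mul, Int.cast_mul]
  have hp0 : 0 < p ^ 2 := pow_pos hp.pos 2
  funext n
  rw [Pi.smul_apply, smul_eq_mul, heckeTSq_three_apply, hχ, hχ2, one_mul, one_mul]
  by_cases hn : IsSquare n
  · obtain ⟨m, rfl⟩ := hn
    rw [show m * m = m ^ 2 by ring, show p ^ 2 * m ^ 2 = (p * m) ^ 2 by ring, hsq, hsq, hmul]
    simp only [Nat.cast_pow]
    by_cases hpm : p ∣ m
    · obtain ⟨m', rfl⟩ := hpm
      rw [jacobiSym_neg_sq_of_dvd hp ⟨m', rfl⟩, if_pos (pow_dvd_pow_of_dvd ⟨m', rfl⟩ 2),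
        show (p * m') ^ 2 / p ^ 2 = m' ^ 2 by rw [mul_pow, Nat.mul_div_cancel_left _ hp0], hsq, hmul]
      push_cast
      linear_combination (-(p : ℂ) * ((ZMod.χ₄ (m' : ZMod 4) : ℤ) : ℂ) * m') * hχ4sq
    · have hndvd : ¬ p ^ 2 ∣ m ^ 2 := fun h ↦ hpm ((Nat.pow_dvd_pow_iff two_ne_zero).mp h)
      rw [jacobiSym_neg_sq_of_not_dvd hp hp2 hpm, if_neg hndvd]
      push_cast
      ring
  · have h1 : ¬ IsSquare (p ^ 2 * n) := fun h ↦ hn (isSquare_of_isSquare_sq_mul hp h)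
    rw [hnsq n hn, hnsq _ h1]
    split_ifs with hdvd
    · have h2 : ¬ IsSquare (n / p ^ 2) := by
        rintro ⟨y, hy⟩
        apply hn
        obtain ⟨m, rfl⟩ := hdvd
        rw [Nat.mul_div_cancel_left _ hp0] at hy
        exact ⟨p * y, by rw [hy]; ring⟩
      rw [hnsq _ h2]
      ring
    · ring

end Literature.NumberTheory.EllipticCurves.ModularForms
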